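import Summits.FinalStateConjecture.FinalStateConjecture.Theorems.StarvedNecksGapDecaySufficesStubAnchoredLocationV2

/-!
# Stub S4 of line `Sketch` (crux `GapDecaySuffices`, stmt-FinalStateConjecture-18060) — v8 form with a
# NON-DEGENERATE anchoring window: `anchoredLocationP_of_seededLocationP`

Skeleton v8 (lead c1, 2026-08-17) restates S4 / S4′ for inputs whose excision radius at the hole under
consideration is EVENTUALLY NON-NEGATIVE (`∀ᶠ s in atTop, 0 ≤ ρᵢ s`; the anchoring window
`[3ρᵢ + 2R₀, 4ρᵢ + 2R₀]` of `TubeAnchoredR` is empty where `ρᵢ < 0`, so nothing can be located there — the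
wave-2 and wave-1 (c1) S4 workers' finding; the clause is supplied by `LabelMatching`'s output in v8 and is
free for the upstream repair `Hf`(4)).  `AnchoredLocationP` / `SeededLocationP` below are the LANDED
`AnchoredV2.AnchoredLocation` / `AnchoredV2.SeededLocation` (p145261) with that single hypothesis inserted
after `∀ i : Fin d.N,`; the reduction `SeededLocationP → AnchoredLocationP` is the landed proof of
`AnchoredV2.anchoredLocation_of_seededLocation` VERBATIM with the hypothesis threaded through (that proof
uses its global hypothesis only at the same input).  No new mathematics; no named facts.
References: as in the V2 file (DHRT arXiv:2104.08222 §1; O'Neill 1983 Ch. 14).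
-/

noncomputable section

open scoped Manifold ContDiff Topology ENNReal
open Filter Set Topology Literature.Geometry.Lorentzian

namespace Summit.FinalStateConjecture.FinalStateConjecture.Theorems.GapDecaySuffices.Location

set_option linter.dupNamespace false

open Summit.FinalStateConjecture.FinalStateConjecture.Theorems.NecksCertifyTwoCap.Cones
  (stub_coneSeparation)
open Summit.FinalStateConjecture.FinalStateConjecture.Theorems.NecksCertify.Negative (rPlus_le_two_mul)

namespace AnchoredP

open AnchoredV2 (HonestCore HonestFar DistinctVelocities TubeAnchoredR)

/-- **(S4, v8) Anchored location for inputs with a non-degenerate anchoring window** — the landed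
`AnchoredV2.AnchoredLocation` with the hypothesis `∀ᶠ s in atTop, 0 ≤ d.excision i s` inserted after the
hole binder (verbatim the skeleton v8 def `AnchoredLocationP`; untagged statement bundle, as in the V2 file). -/
def AnchoredLocationP : Prop :=
  ∀ (X : Type) [TopologicalSpace X] [ChartedSpace E3 X] [IsManifold (𝓡 3) ∞ X] [ConnectedSpace X]
    (D : InitialDataSet (𝓡 3) X), D ∈ admissibleVacuumData X →
    ∀ 𝒟 : VacuumCauchyDevelopment D, 𝒟.IsMaximal →
    ∀ (O : Set 𝒟.carrier) (d : FinalStateDecomposition 𝒟.toSpacetime O 4) (R₀ : ℝ),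
      O = exteriorOf 𝒟.toCauchyDevelopment d.charted →
      HonestCore 𝒟.toSpacetime O 4 d R₀ → HonestFar 𝒟.toSpacetime O 4 d R₀ →
      DistinctVelocities 𝒟.toSpacetime O 4 d → TubeAnchoredR d R₀ →
      ∀ i : Fin d.N, (∀ᶠ s in atTop, 0 ≤ d.excision i s) →
      ∃ Bk : ℝ → ℝ, Tendsto (fun s ↦ Bk s / s) atTop (𝓝 0) ∧
      ∀ (ρ' : ℝ → ℝ), Monotone ρ' → Continuous ρ' → ConcaveOn ℝ (Set.Ici 0) ρ' →
        Tendsto (fun s ↦ ρ' s / s) atTop (𝓝 0) →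
        Tendsto (fun s ↦ Bk s / ρ' s) atTop (𝓝 0) → (∀ s, 1 ≤ ρ' s) →
      ∀ (R₁ τ₁ : ℝ) (W : ℝ → ℝ) (Ψg : (d.background i).domain → 𝒟.carrier),
        let B := d.background i; let t := B.time; let r := B.radius;
        R₀ ≤ R₁ → d.τ₀ ≤ τ₁ → Continuous W → (∀ s, τ₁ ≤ s → 3 * ρ' s + 2 ≤ W s) →
        (let U : Set B.domain := {x | τ₁ < t x.1 ∧ r x.1 < W (x.1 0) + 1};
          ContMDiffOn 𝓘(ℝ, E4) (𝓡 4) ∞ Ψg U ∧ Topology.IsOpenEmbedding (U.restrict Ψg) ∧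
            Ψg '' U ⊆ d.charted) →
        (∀ x : B.domain, r x.1 ≤ R₁ + 1 → Ψg x = d.chart i x) →
        Tendsto (fun τ ↦ supCkENorm (Subtype.val '' {x : B.domain | t x.1 = τ ∧ r x.1 ≤ W (x.1 0)}) 2
          (𝒟.toSpacetime.deviationExtend B Ψg)) atTop (𝓝 0) →
        (∀ x : B.domain, τ₁ ≤ t x.1 → R₁ ≤ r x.1 → r x.1 ≤ W (x.1 0) →
          𝒟.toSpacetime.timeOrientation.IsFutureDirected
            (mfderiv 𝓘(ℝ, E4) (𝓡 4) Ψg x (((d.motion i).1 : E4 ≃L[ℝ] E4) (E4.basisVector 0)))) →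
        (∀ (τ' : ℝ) (ϱ : ℝ → ℝ), Continuous ϱ → τ₁ < τ' →
          (∀ x : B.domain, τ' ≤ t x.1 → r x.1 ≤ ϱ (t x.1) → r x.1 ≤ W (x.1 0)) →
          closure (Ψg '' {x | τ' ≤ t x.1 ∧ r x.1 ≤ ϱ (t x.1)}) ∩ O ⊆
            Ψg '' {x | τ' ≤ t x.1 ∧ r x.1 ≤ ϱ (t x.1)}) →
        ∃ (τ₂ : ℝ) (κ : ℝ → ℝ), τ₁ ≤ τ₂ ∧ Tendsto κ atTop (𝓝 0) ∧
          ∀ (y : E4) (hy : y ∈ B.domain), τ₂ < t y → 11 / 10 * ρ' (y 0) ≤ r y →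
            r y ≤ 29 / 10 * ρ' (y 0) →
            ∃ hy' : y ∈ d.flatDomain, d.τ₀ < y 0 ∧
              (∀ j, d.excision j (y 0) + 1 ≤ (d.background j).radius y) ∧
              ∃ x : B.domain, τ₁ < t x.1 ∧ r x.1 < W (x.1 0) ∧ Ψg x = d.flatChart ⟨y, hy'⟩ ∧
                |t x.1 - t y| ≤ κ (t y) * ρ' (y 0) ∧ |r x.1 - r y| ≤ κ (t y) * ρ' (y 0)

/-- **(S4′, v8) Seeded location for inputs with a non-degenerate anchoring window** — the landed
`AnchoredV2.SeededLocation` with the same hypothesis inserted (verbatim the skeleton v8 def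
`SeededLocationP`; untagged statement bundle). -/
def SeededLocationP : Prop :=
  ∀ (X : Type) [TopologicalSpace X] [ChartedSpace E3 X] [IsManifold (𝓡 3) ∞ X] [ConnectedSpace X]
    (D : InitialDataSet (𝓡 3) X), D ∈ admissibleVacuumData X →
    ∀ 𝒟 : VacuumCauchyDevelopment D, 𝒟.IsMaximal →
    ∀ (O : Set 𝒟.carrier) (d : FinalStateDecomposition 𝒟.toSpacetime O 4) (R₀ : ℝ),
      O = exteriorOf 𝒟.toCauchyDevelopment d.charted →
      HonestCore 𝒟.toSpacetime O 4 d R₀ → HonestFar 𝒟.toSpacetime O 4 d R₀ →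
      DistinctVelocities 𝒟.toSpacetime O 4 d → TubeAnchoredR d R₀ →
      ∀ i : Fin d.N, (∀ᶠ s in atTop, 0 ≤ d.excision i s) →
      ∃ Bk : ℝ → ℝ, Tendsto (fun s ↦ Bk s / s) atTop (𝓝 0) ∧
      ∀ (ρ' : ℝ → ℝ), Monotone ρ' → Continuous ρ' → ConcaveOn ℝ (Set.Ici 0) ρ' →
        Tendsto (fun s ↦ ρ' s / s) atTop (𝓝 0) →
        Tendsto (fun s ↦ Bk s / ρ' s) atTop (𝓝 0) → (∀ s, 1 ≤ ρ' s) →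
      ∀ (R₁ τ₁ : ℝ) (W : ℝ → ℝ) (Ψg : (d.background i).domain → 𝒟.carrier),
        let B := d.background i; let t := B.time; let r := B.radius;
        R₀ ≤ R₁ → d.τ₀ ≤ τ₁ → Continuous W → (∀ s, τ₁ ≤ s → 3 * ρ' s + 2 ≤ W s) →
        (let U : Set B.domain := {x | τ₁ < t x.1 ∧ r x.1 < W (x.1 0) + 1};
          ContMDiffOn 𝓘(ℝ, E4) (𝓡 4) ∞ Ψg U ∧ Topology.IsOpenEmbedding (U.restrict Ψg) ∧
            Ψg '' U ⊆ d.charted) →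
        (∀ x : B.domain, r x.1 ≤ R₁ + 1 → Ψg x = d.chart i x) →
        Tendsto (fun τ ↦ supCkENorm (Subtype.val '' {x : B.domain | t x.1 = τ ∧ r x.1 ≤ W (x.1 0)}) 2
          (𝒟.toSpacetime.deviationExtend B Ψg)) atTop (𝓝 0) →
        (∀ x : B.domain, τ₁ ≤ t x.1 → R₁ ≤ r x.1 → r x.1 ≤ W (x.1 0) →
          𝒟.toSpacetime.timeOrientation.IsFutureDirected
            (mfderiv 𝓘(ℝ, E4) (𝓡 4) Ψg x (((d.motion i).1 : E4 ≃L[ℝ] E4) (E4.basisVector 0)))) →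
        (∀ (τ' : ℝ) (ϱ : ℝ → ℝ), Continuous ϱ → τ₁ < τ' →
          (∀ x : B.domain, τ' ≤ t x.1 → r x.1 ≤ ϱ (t x.1) → r x.1 ≤ W (x.1 0)) →
          closure (Ψg '' {x | τ' ≤ t x.1 ∧ r x.1 ≤ ϱ (t x.1)}) ∩ O ⊆
            Ψg '' {x | τ' ≤ t x.1 ∧ r x.1 ≤ ϱ (t x.1)}) →
        ∃ (T τ' : ℝ) (ϱ rs κ : ℝ → ℝ), τ₁ < τ' ∧ Continuous ϱ ∧ Tendsto κ atTop (𝓝 0) ∧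
          (∀ x : B.domain, τ' ≤ t x.1 → r x.1 ≤ ϱ (t x.1) → r x.1 < W (x.1 0)) ∧
          (∀ s, T ≤ s → R₀ ≤ rs s ∧ d.excision i s < rs s ∧ rs s < 11 / 10 * ρ' s) ∧
          (∀ (z : E4) (hz : z ∈ d.flatDomain), T ≤ z 0 → r z = rs (z 0) →
            ∃ x : B.domain, τ' < t x.1 ∧ r x.1 < ϱ (t x.1) ∧ Ψg x = d.flatChart ⟨z, hz⟩) ∧
          (∀ (z : E4) (hz : z ∈ d.flatDomain), T ≤ z 0 → rs (z 0) ≤ r z →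
            r z ≤ 29 / 10 * ρ' (z 0) →
            ∀ x : B.domain, τ' ≤ t x.1 → r x.1 ≤ ϱ (t x.1) → Ψg x = d.flatChart ⟨z, hz⟩ →
              τ' < t x.1 ∧ r x.1 < ϱ (t x.1)) ∧
          (∀ (z : E4) (hz : z ∈ d.flatDomain), T ≤ z 0 → 11 / 10 * ρ' (z 0) ≤ r z →
            r z ≤ 29 / 10 * ρ' (z 0) →
            ∀ x : B.domain, τ' < t x.1 → r x.1 < ϱ (t x.1) → Ψg x = d.flatChart ⟨z, hz⟩ →
              |t x.1 - t z| ≤ κ (t z) * ρ' (z 0) ∧ |r x.1 - r z| ≤ κ (t z) * ρ' (z 0))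

/-! ## The reduction (registered header `anchoredLocationP_of_seededLocationP`) -/

set_option maxHeartbeats 800000 in
/-- **S4 from S4′, v8 form** (registered reduction header of skeleton v8): the landed proof of
`AnchoredV2.anchoredLocation_of_seededLocation` with the non-negativity hypothesis threaded through —
late-flatness of the collar and of the constant-lab-time rays (clock bound, cone separation p106992,
sublinearity), entry of every collar point by clopen continuation along its ray (`flat_entry_gapTube`),
seeded on the seed sphere and located by the hypothesis. [folklore] -/
theorem anchoredLocationP_of_seededLocationP : SeededLocationP → AnchoredLocationP := by
  intro hX X _ _ _ _ D hD 𝒟 h𝒟 O d R₀ hO hc hf hdv hanch i hnn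
  obtain ⟨Bk, hBk, hX'⟩ := hX X D hD 𝒟 h𝒟 O d R₀ hO hc hf hdv hanch i hnn
  refine ⟨fun s ↦ max |Bk s| (d.excision i s + 1),
    tendsto_max_abs_add_one_div hBk (d.tendsto_excision_div i), ?_⟩
  intro ρ' hmono hcont hconc hsub hdom hone R₁ τ₁ W Ψg B t r hR hτ hW hwall hG1 hG2 hG3 hG4 hG5
  -- positivity of `ρ'`
  have hρpos : ∀ s, 0 < ρ' s := fun s ↦ lt_of_lt_of_le one_pos (hone s)
  -- the two consequences of the domination hypothesis
  have hdomBk : Tendsto (fun s ↦ Bk s / ρ' s) atTop (𝓝 0) := by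
    refine squeeze_zero_norm' ?_ hdom
    filter_upwards with s
    rw [Real.norm_eq_abs, abs_div, abs_of_pos (hρpos s)]
    exact div_le_div_of_nonneg_right (le_max_left _ _) (hρpos s).le
  have hexc : ∀ᶠ s in atTop, d.excision i s + 1 ≤ 11 / 10 * ρ' s := by
    filter_upwards [hdom.eventually (gt_mem_nhds one_pos)] with s hs
    rw [div_lt_one (hρpos s)] at hs
    linarith [le_max_right |Bk s| (d.excision i s + 1), hρpos s]
  -- the isolated input
  obtain ⟨T, τ', ϱ, rs, κ, hτ', hϱ, hκ, hadm, hrs, hseed, hrim, hloc⟩ :=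
    hX' ρ' hmono hcont hconc hsub hdomBk hone R₁ τ₁ W Ψg hR hτ hW hwall hG1 hG2 hG3 hG4 hG5
  -- orthochronicity, distinct velocities, cone separation
  have horth : ∀ j, 0 < ((d.motion j).1 : E4 ≃L[ℝ] E4) (E4.basisVector 0) 0 := fun j ↦ (hc.1 j).2.2
  obtain ⟨c, hc0, τc, hcone⟩ := stub_coneSeparation _ O 4 d horth hdv
  -- eventual facts in the flat time `s`
  have hE2 : ∀ᶠ s in atTop, ∀ j, d.excision j s + 1 ≤ c * s := by
    refine Filter.eventually_all.2 fun j ↦ ?_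
    have h1 : ∀ᶠ s in atTop, d.excision j s / s < c / 2 :=
      (d.tendsto_excision_div j).eventually (gt_mem_nhds (by positivity))
    filter_upwards [h1, eventually_gt_atTop (0 : ℝ), eventually_ge_atTop (2 / c)] with s hs hs0 hs2
    rw [div_lt_iff₀ hs0] at hs
    rw [div_le_iff₀' hc0] at hs2
    linarith
  have hE3 : ∀ᶠ s in atTop, 29 / 10 * ρ' s ≤ c * s := by
    have h1 : ∀ᶠ s in atTop, ρ' s / s < c / 3 := hsub.eventually (gt_mem_nhds (by positivity))
    filter_upwards [h1, eventually_gt_atTop (0 : ℝ)] with s hs hs0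
    rw [div_lt_iff₀ hs0] at hs
    linarith [hρpos s]
  obtain ⟨T₀, hT₀⟩ := Filter.eventually_atTop.1
    (hexc.and (hE2.and (hE3.and ((eventually_ge_atTop τc).and
      ((eventually_gt_atTop d.τ₀).and (eventually_ge_atTop T))))))
  -- the clock constants of hole `i` and the choice of `τ₂`
  obtain ⟨γ, hγ⟩ : ∃ γ : ℝ, γ = (((d.motion i).1 : E4 ≃L[ℝ] E4) (E4.basisVector 0)) 0 := ⟨_, rfl⟩
  have hγ0 : 0 < γ := hγ ▸ horth i
  obtain ⟨S₀, hS₀⟩ : ∃ S₀ : ℝ, S₀ = Real.sqrt (γ ^ 2 - 1) * (29 / 10 * ρ' T₀ + |d.spin i|) :=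
    ⟨_, rfl⟩
  refine ⟨max τ₁ ((T₀ - (d.motion i).2 0 + S₀) / γ), κ, le_max_left _ _, hκ, ?_⟩
  intro y hyB hty hlo hhi
  -- the flat time `s = y⁰` of the collar point is late
  have hclock : (d.motion i).2 0 + γ * t y -
      Real.sqrt (γ ^ 2 - 1) * (r y + |d.spin i|) ≤ y 0 := by
    have h := stub_flatTimeGe (d.motion i).1 (d.motion i).2 (d.mass i) (d.spin i) y
    rw [← hγ] at h
    exact h
  have hT' : T₀ ≤ y 0 := by
    by_contra hlt
    rw [not_le] at hlt
    have h1 : ρ' (y 0) ≤ ρ' T₀ := hmono hlt.le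
    have h2 : r y ≤ 29 / 10 * ρ' T₀ := hhi.trans (by linarith)
    have h3 : Real.sqrt (γ ^ 2 - 1) * (r y + |d.spin i|) ≤ S₀ := by
      rw [hS₀]
      exact mul_le_mul_of_nonneg_left (by linarith) (Real.sqrt_nonneg _)
    have h4 : (T₀ - (d.motion i).2 0 + S₀) / γ < t y := lt_of_le_of_lt (le_max_right _ _) hty
    rw [div_lt_iff₀ hγ0] at h4
    linarith
  obtain ⟨hx1, hx2, hx3, hx4, hx5, hx6⟩ := hT₀ (y 0) hT'
  obtain ⟨hrsR, hrsρ, hrs11⟩ := hrs (y 0) hx6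
  -- late-flatness of every point of flat time `y⁰` with radius in `[rs(y⁰), rᵢ y]`
  have hflat : ∀ z : E4, z 0 = y 0 → rs (y 0) ≤ r z → r z ≤ r y →
      z ∈ d.flatDomain ∧ d.τ₀ < z 0 ∧
        ∀ j, j ≠ i → d.excision j (z 0) + 1 ≤ (d.background j).radius z := by
    intro z hz0 hzlo hzhi
    have hri : (d.background i).radius z ≤ c * z 0 := by
      rw [hz0]
      exact (hzhi.trans hhi).trans hx3
    have hother : ∀ j, j ≠ i → d.excision j (z 0) + 1 ≤ (d.background j).radius z := by
      intro j hij
      have h := hcone i j z (Ne.symm hij) (by rw [hz0]; exact hx4) hri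
      rw [hz0] at h ⊢
      linarith [hx2 j]
    refine ⟨d.setOf_lt_excision_subset_flatDomain ⟨by rw [hz0]; exact hx5, fun j ↦ ?_⟩,
      by rw [hz0]; exact hx5, hother⟩
    show d.excision j (z 0) < (d.background j).radius z
    rcases eq_or_ne j i with rfl | hij
    · rw [hz0]
      exact lt_of_lt_of_le hrsρ hzlo
    · linarith [hother j hij]
  -- the constant-lab-time ray from `y` down to the seed sphere
  have hmass : 0 < d.mass i := d.mass_pos i
  have hr₀ : max (Kerr.rPlus (d.mass i) (d.spin i)) 0 < rs (y 0) := by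
    refine max_lt ?_ (by linarith [(hc.1 i).2.1])
    have := rPlus_le_two_mul hmass.le (d.spin i)
    linarith [(hc.1 i).2.1]
  have hr₀y : rs (y 0) ≤ r y := by linarith
  obtain ⟨S, hSpre, hyS, hSdom, hSprop, z₀, hz₀S, hz₀r⟩ :=
    exists_ray_constLabTime (d.motion i).1 (d.motion i).2 (d.mass i) (d.spin i) (horth i) y hr₀ hr₀y
  have hSf : S ⊆ (d.flatDomain : Set E4) := fun z hz ↦
    (hflat z (hSprop z hz).1 (hSprop z hz).2.1 (hSprop z hz).2.2).1
  have hSlate : ∀ z ∈ S, d.τ₀ < z 0 := fun z hz ↦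
    (hflat z (hSprop z hz).1 (hSprop z hz).2.1 (hSprop z hz).2.2).2.1
  -- entry along the ray
  have hadm' : ∀ x : B.domain, τ' ≤ t x.1 → r x.1 ≤ ϱ (t x.1) → r x.1 ≤ W (x.1 0) :=
    fun x h1 h2 ↦ (hadm x h1 h2).le
  have hentry := flat_entry_gapTube d i hG1.2.1 (hG5 τ' ϱ hϱ hτ' hadm') hϱ hτ' hadm' hSpre hSf hSlate
    (fun z hz x hx1 hx2 hhx ↦ by
      obtain ⟨hz0, hzlo, hzhi⟩ := hSprop z hz
      exact hrim z (hSf hz) (by rw [hz0]; exact hx6) (by rw [hz0]; exact hzlo)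
        (by rw [hz0]; exact hzhi.trans hhi) x hx1 hx2 hhx)
    (by
      obtain ⟨hz0, -, -⟩ := hSprop z₀ hz₀S
      obtain ⟨x, hx1, hx2, hhx⟩ := hseed z₀ (hSf hz₀S) (by rw [hz0]; exact hx6) (by rw [hz0]; exact hz₀r)
      exact ⟨z₀, hz₀S, x, hx1, hx2, hhx⟩)
  obtain ⟨x, hx1, hx2, hhx⟩ := hentry y hyS
  -- conclusion
  have hyflat := hflat y rfl hr₀y le_rfl
  refine ⟨hyflat.1, hyflat.2.1, fun j ↦ ?_, x, lt_trans hτ' hx1, hadm x hx1.le hx2.le, hhx,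
    hloc y hyflat.1 hx6 hlo hhi x hx1 hx2 hhx⟩
  rcases eq_or_ne j i with rfl | hij
  · linarith
  · exact hyflat.2.2 j hij

end AnchoredP

end Summit.FinalStateConjecture.FinalStateConjecture.Theorems.GapDecaySuffices.Location

end
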